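import Summits.ResolutionOfSingularities.ResolutionOfSingularities.Theorems.SharpStrataSepExcModelsSepAbhyankarModel
import Summits.ResolutionOfSingularities.ResolutionOfSingularities.Theorems.SharpStrataSepExcModelsModelValuation
import Mathlib.AlgebraicGeometry.FunctionField
import Mathlib.AlgebraicGeometry.Morphisms.FiniteType
import HarnessLib

/-!
# Separably exceptional local models at `ζ` ⟺ separable Abhyankar places centred at `ζ`

Line `birth` of crux `SharpStrata.SepExcModels` (stmt-ResolutionOfSingularities-16828,
`Cruxes/SepExcModels/Lines/birth.lean`), lead c1, tool stub (T7, SCHEME form of the valuative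
criterion, as ONE `Iff` at a point of a variety) `stub_sepExcModel_iff_sepAbhyankarPlace`, PROVED.

Setting: `k` perfect, `Y` an integral scheme locally of finite type over `k`, `ζ ∈ Y`; `k` is
embedded in the function field through `k = Γ(Spec k) → Γ(Y, ⊤) → K(Y)`. Statement: the THIRD
DISJUNCT of `SepExcAt Y ζ` (`Theorems/SharpStrataSepExcModelsDefs.lean`) — a finitely generated
birational local model `B = 𝒪_{Y,ζ}[s] ⊆ K(Y)` with a prime `𝔮` over `𝔪_ζ`, `B_𝔮` regular and
`(B/𝔮)[1/g]` smooth over `κ(ζ)` for some `g ∉ 𝔮` — holds IF AND ONLY IF some valuation ring `O` of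
`K(Y)` receives `𝒪_{Y,ζ}` (compatibly with `𝒪_{Y,ζ} → K(Y)`), dominates it (`𝔪_ζ ⊆ 𝔪_O`), is an
ABHYANKAR place of `K(Y) | k` (`IsAbhyankarPlace`, `Literature/…/ValuedFunctionFields.lean`) and
has residue field `κ(O)` FORMALLY SMOOTH (= separable; it is finitely generated) over `κ(ζ)`.
"Separably exceptional ⟺ valuatively blunt."

## Proof

Scheme dress, done once for both directions, of the two ring theorems
`SepAbhyankarModel.stub_model_of_sepAbhyankarPlace` (⟸, `Theorems/…SepAbhyankarModel.lean`;
Knaf–Kuhlmann 2005, Thm. 1.1, needs `k` perfect) and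
`ModelValuation.stub_sepAbhyankarPlace_of_model` (⟹, `Theorems/…ModelValuation.lean`; the order
valuation of the regular local ring `B_𝔮` is a prime divisor, Zariski–Samuel VI §14 Thm. 31):
choose an affine open `V = Spec A ∋ ζ`; `A = Γ(Y, V)` is a finitely generated `k`-algebra
(`HasRingHomProperty.appLE` for `LocallyOfFiniteType`), `K(Y) = Frac A`
(Mathlib `functionField_isFractionRing_of_isAffineOpen`), `𝒪_{Y,ζ} = A_P` inside `K(Y)` for the
prime `P` of `ζ` (Mathlib `IsAffineOpen.isLocalization_stalk`, `functionField_isScalarTower`), and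
`K(Y) / k` is finitely generated as a field (`IntermediateField.fg_top_iff`: it is essentially of
finite type, being a localisation of the finitely generated `A`). Both ring theorems are stated for
exactly this datum `(k, A, K(Y), 𝒪_{Y,ζ}, P)`, and the two sides of the `Iff` are their hypotheses
and conclusions verbatim — exactly as `RatAbhyankarPoint.stub_sepExcAt_of_ratAbhyankarPlace`
(`Theorems/…RatAbhyankarPoint.lean`) assembles the residually rational case.

## Sources

* H. Knaf, F.-V. Kuhlmann, *Abhyankar places admit local uniformization in any characteristic*,
  Ann. Sci. ÉNS 38 (2005) 833–846, Thm. 1.1. [KnafKuhlmann2005]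
* O. Zariski, P. Samuel, *Commutative Algebra* II (1960), Ch. VI §14, Thm. 31 (prime divisors).
  [ZariskiSamuel1960]
* A. Benito, O. Piltant, A. J. Reguera, *Small irreducible components of arc spaces in positive
  characteristic*, J. Pure Appl. Algebra 226 (2022) 107113, Question 6.6 and Lemma 4.2.
  [BenitoPiltantReguera2022]
-/

noncomputable section

-- single-problem summit: the doubled namespace component `ResolutionOfSingularities` is forced
set_option linter.dupNamespace false

open CategoryTheory AlgebraicGeometry TopologicalSpace
open Literature.AlgebraicGeometry.Resolution IsLocalRing
open Summit.ResolutionOfSingularities.ResolutionOfSingularities.Theorems.SepExcModels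

namespace Summit.ResolutionOfSingularities.ResolutionOfSingularities.Theorems.SepExcModels.SepAbhyankarPoint

/-- **Separably exceptional local models at `ζ` ⟺ separable Abhyankar places centred at `ζ`**
(registered tool stub T7, scheme form, of line `birth` of crux `SepExcModels`: the valuative
criterion as one `Iff` at a point of a variety). For an integral `Y` locally of finite type over a
perfect field `k` and `ζ ∈ Y`: the third disjunct of `SepExcAt Y ζ` (a finitely generated
birational local model `B = 𝒪_{Y,ζ}[s] ⊆ K(Y)`, a prime `𝔮` of `B` over `𝔪_ζ` with `B_𝔮` regular
and `(B/𝔮)[1/g]` smooth over `κ(ζ)` for some `g ∉ 𝔮`; the `letI` algebra written as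
`@Algebra.Smooth … (…).toAlgebra`) holds iff some valuation ring `O` of `K(Y)` receives `𝒪_{Y,ζ}`
compatibly with `K(Y)`, dominates it, is an Abhyankar place of `K(Y) | k`
(w.r.t. `k → Γ(Spec k) → Γ(Y,⊤) → K(Y)`) and has residue field formally smooth over `κ(ζ)`.
Assembly, over an affine chart `Spec A ∋ ζ` (`𝒪_{Y,ζ} = A_P` inside `K(Y) = Frac A` by
`IsAffineOpen.isLocalization_stalk` and `functionField_isFractionRing_of_isAffineOpen`, `K(Y)/k`
finitely generated by `IntermediateField.fg_top_iff`), of the ring theorems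
`ModelValuation.stub_sepAbhyankarPlace_of_model` (⟹: the order valuation of `B_𝔮` is a separable
prime divisor) and `SepAbhyankarModel.stub_model_of_sepAbhyankarPlace` (⟸: Knaf–Kuhlmann local
uniformization at an Abhyankar place over a perfect field, plus descent of MacLane's condition to
`Frac(B/𝔮) ⊆ κ(O)`). [cite: KnafKuhlmann2005, Thm. 1.1; ZariskiSamuel1960, VI §14 Thm. 31] -/
theorem stub_sepExcModel_iff_sepAbhyankarPlace (k : Type) [Field k] [PerfectField k]
    (Y : Scheme.{0}) [IsIntegral Y] (f : Y ⟶ Spec (.of k)) [LocallyOfFiniteType f] (ζ : Y) :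
    (∃ (s : Finset Y.functionField)
        (𝔮 : Ideal (Algebra.adjoin (Y.presheaf.stalk ζ) (s : Set Y.functionField))) (_ : 𝔮.IsPrime)
        (hle : IsLocalRing.maximalIdeal (Y.presheaf.stalk ζ) ≤
          𝔮.comap (algebraMap (Y.presheaf.stalk ζ)
            (Algebra.adjoin (Y.presheaf.stalk ζ) (s : Set Y.functionField)))),
        IsRegularLocalRing (Localization.AtPrime 𝔮) ∧
          ∃ g : Algebra.adjoin (Y.presheaf.stalk ζ) (s : Set Y.functionField), g ∉ 𝔮 ∧
            @Algebra.Smooth (Y.presheaf.stalk ζ ⧸ IsLocalRing.maximalIdeal (Y.presheaf.stalk ζ)) _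
              (Localization.Away (Ideal.Quotient.mk 𝔮 g)) _
              ((algebraMap _ (Localization.Away (Ideal.Quotient.mk 𝔮 g))).comp
                (Ideal.quotientMap 𝔮 (algebraMap (Y.presheaf.stalk ζ)
                  (Algebra.adjoin (Y.presheaf.stalk ζ) (s : Set Y.functionField))) hle)).toAlgebra) ↔
    ∃ (O : ValuationSubring Y.functionField) (φ : Y.presheaf.stalk ζ →+* O)
      (_ : ∀ r, (φ r : Y.functionField) = algebraMap (Y.presheaf.stalk ζ) Y.functionField r)
      (hdom : IsLocalRing.maximalIdeal (Y.presheaf.stalk ζ) ≤ (IsLocalRing.maximalIdeal O).comap φ),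
      IsAbhyankarPlace O ((Y.presheaf.germ ⊤ (genericPoint Y) trivial).hom.comp
        (f.appTop.hom.comp (Scheme.ΓSpecIso (.of k)).inv.hom)).fieldRange ⊤ ∧
      @Algebra.FormallySmooth (Y.presheaf.stalk ζ ⧸ IsLocalRing.maximalIdeal (Y.presheaf.stalk ζ))
        (O ⧸ IsLocalRing.maximalIdeal O) _ _
        (Ideal.quotientMap (IsLocalRing.maximalIdeal O) φ hdom).toAlgebra := by
  classical
  -- the `k`-algebra structure on `K(Y)`: `k = Γ(Spec k) → Γ(Y, ⊤) → K(Y)`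
  let ι : k →+* Γ(Spec (CommRingCat.of k), ⊤) := (Scheme.ΓSpecIso (CommRingCat.of k)).inv.hom
  letI algK : Algebra k Y.functionField :=
    ((Y.presheaf.germ ⊤ (genericPoint Y) trivial).hom.comp (f.appTop.hom.comp ι)).toAlgebra
  -- an affine open neighbourhood `V = Spec A` of `ζ`; `A` is of finite type over `k`
  obtain ⟨V, hV, hζV, -⟩ := exists_isAffineOpen_mem_and_subset (X := Y) (x := ζ) (U := ⊤) trivial
  haveI : Nonempty V := ⟨⟨ζ, hζV⟩⟩
  have hηV : genericPoint Y ∈ V :=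
    ((genericPoint_spec Y).mem_open_set_iff V.isOpen).mpr (by simpa using ‹Nonempty V›)
  have hφ : RingHom.FiniteType (f.appLE ⊤ V le_top).hom :=
    HasRingHomProperty.appLE @LocallyOfFiniteType f ‹_› ⟨⊤, isAffineOpen_top _⟩ ⟨V, hV⟩ le_top
  have hψ : RingHom.FiniteType ((f.appLE ⊤ V le_top).hom.comp ι) :=
    hφ.comp (RingHom.FiniteType.of_surjective _
      (Scheme.ΓSpecIso (CommRingCat.of k)).symm.commRingCatIsoToRingEquiv.surjective)
  letI algV : Algebra k Γ(Y, V) := ((f.appLE ⊤ V le_top).hom.comp ι).toAlgebra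
  haveI : Algebra.FiniteType k Γ(Y, V) := hψ
  -- the stalk at `ζ` is the localisation of `A` at the prime of `ζ`, inside `K(Y) = Frac A`
  letI := TopCat.Presheaf.algebra_section_stalk Y.presheaf (⟨ζ, hζV⟩ : V)
  haveI := functionField_isScalarTower Y V ⟨ζ, hζV⟩
  haveI := hV.isLocalization_stalk ⟨ζ, hζV⟩
  haveI : IsFractionRing Γ(Y, V) Y.functionField :=
    functionField_isFractionRing_of_isAffineOpen Y V hV
  -- `k → A → K(Y)` is the structure map of `K(Y)`
  haveI : IsScalarTower k Γ(Y, V) Y.functionField := by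
    refine IsScalarTower.of_algebraMap_eq fun c => ?_
    change (Y.presheaf.germ ⊤ (genericPoint Y) trivial) (f.appTop (ι c)) =
      Y.germToFunctionField V ((f.app ⊤ ≫ Y.presheaf.map (homOfLE le_top).op) (ι c))
    have hres := TopCat.Presheaf.germ_res Y.presheaf (homOfLE (le_top : V ≤ ⊤)) (genericPoint Y)
      hηV
    rw [Scheme.germToFunctionField, ← hres]
    rfl
  -- `K(Y) / k` is finitely generated as a field
  haveI : Algebra.EssFiniteType Γ(Y, V) Y.functionField :=
    Algebra.EssFiniteType.of_isLocalization _ (nonZeroDivisors Γ(Y, V))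
  haveI : Algebra.EssFiniteType k Y.functionField :=
    Algebra.EssFiniteType.comp k Γ(Y, V) Y.functionField
  have hfg : (⊤ : IntermediateField k Y.functionField).FG :=
    IntermediateField.fg_top_iff.mpr inferInstance
  -- the two ring forms, at `R = 𝒪_{Y,ζ} = A_P`, are the two directions verbatim
  refine ⟨fun h => ?_, fun h => ?_⟩
  · -- (⟹) the order valuation of the regular local ring `B_𝔮`
    obtain ⟨s, 𝔮, h𝔮, hle, hreg, g, hg, hsm⟩ := h
    haveI := h𝔮
    exact ModelValuation.stub_sepAbhyankarPlace_of_model (k := k)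
      (hV.primeIdealOf ⟨ζ, hζV⟩).asIdeal s 𝔮 hle hreg g hg hsm
  · -- (⟸) Knaf–Kuhlmann at the Abhyankar place, over the perfect field `k`
    obtain ⟨O, φ, hφO, hdom, hAbh, hsep⟩ := h
    exact SepAbhyankarModel.stub_model_of_sepAbhyankarPlace
      (hV.primeIdealOf ⟨ζ, hζV⟩).asIdeal hfg O φ hφO hdom hAbh hsep

end Summit.ResolutionOfSingularities.ResolutionOfSingularities.Theorems.SepExcModels.SepAbhyankarPoint

end
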